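import Summits.NavierStokesRegularity.FunctionalMining.StretchingConfinementCalculus
import Literature.Analysis.FunctionSpaces.TorusInverseLaplacianCalculus
import Literature.Analysis.FunctionSpaces.TorusCalculusProofs
import Literature.Analysis.FunctionSpaces.TorusEnstrophyOrthogonality
import HarnessLib

/-!
# K1-Q1, the wrap blueprint: every smooth divergence-free field is a curl up to its mean

Cell `pub-nsfunc` (host summit NavierStokesRegularity, topic `FunctionalMining`), prove seat gen 5, towards node N3
(`PlanarFillerFamilyPot±`) of the bank seat's `WRAP-KERNEL-BLUEPRINT.md`. **Search for candidate a priori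
estimates; no regularity claim.** Static facts about smooth fields on `T³`.

For a smooth divergence-free `u` on `T³` the potential `A = −curl(Δ⁻¹u)` (literature's `Torus.invLaplacian`) is
smooth and `curl A = u − ∫u`: the vector identity `curl curl B = ∇(div B) − ΔB`, `div Δ⁻¹u = Δ⁻¹ div u = 0`
and `Δ Δ⁻¹u = u − ∫u`. Consequently the gradient statistics (`|ω|²`, `ℰ`, `σ`, `T_ii`) of `curl A` are those of
`u`: this turns any explicit divergence-free filler into the potential form the confinement lemma consumes.
-/

noncomputable section

open MeasureTheory Set Filter Topology Function
open scoped InnerProductSpace ContDiff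

namespace Summit.NavierStokesRegularity.FunctionalMining

open Literature.Analysis Literature.Analysis.FunctionSpaces Literature.Analysis.FunctionSpaces.Torus
open Literature.Analysis.FluidPDE Literature.Analysis.FluidPDE.Torus

namespace Confinement

open CellularStretching WrapStretching

/-! ## 1. `curl curl B = ∇ div B − ΔB` -/

/-- `(curl V)_i = vort(∇V)_i`. [ours; bookkeeping] -/
theorem curlField_eq_vort (V : UnitAddTorus (Fin 3) → EuclideanSpace ℝ (Fin 3)) (x : UnitAddTorus (Fin 3))
    (i : Fin 3) : curlField V x i = gradAt V x (i + 2) (i + 1) - gradAt V x (i + 1) (i + 2) := by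
  rw [curlField_apply]; rfl

/-- **`curl curl B = ∇(div B) − ΔB`** componentwise:
`(curl curl B)_i = ∑ⱼ (∂ᵢ∂ⱼB)ⱼ − ∑ⱼ (∂ⱼ∂ⱼB)ᵢ`. [folklore] -/
theorem curl_curl {B : UnitAddTorus (Fin 3) → EuclideanSpace ℝ (Fin 3)} (hB : IsSmooth B)
    (x : UnitAddTorus (Fin 3)) (i : Fin 3) :
    curlField (curlField B) x i =
      ∑ j, Torus.partialDeriv i (Torus.partialDeriv j B) x j - ∑ j, Torus.partialDeriv j (Torus.partialDeriv j B) x i := by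
  rw [curlField_eq_vort, gradAt_curlField hB, gradAt_curlField hB]
  have c := fun a b => partialDeriv_comm hB a b x
  fin_cases i
  · simp only [Fin.sum_univ_three, show (0 : Fin 3) + 1 = 1 from rfl, show (0 : Fin 3) + 2 = 2 from rfl,
      show (1 : Fin 3) + 1 = 2 from rfl, show (1 : Fin 3) + 2 = 0 from rfl, show (2 : Fin 3) + 1 = 0 from rfl,
      show (2 : Fin 3) + 2 = 1 from rfl, Fin.zero_eta]
    rw [c 1 0, c 2 0]; ring
  · simp only [Fin.sum_univ_three, show (0 : Fin 3) + 1 = 1 from rfl, show (0 : Fin 3) + 2 = 2 from rfl,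
      show (1 : Fin 3) + 1 = 2 from rfl, show (1 : Fin 3) + 2 = 0 from rfl, show (2 : Fin 3) + 1 = 0 from rfl,
      show (2 : Fin 3) + 2 = 1 from rfl, Fin.mk_one]
    rw [c 2 1, c 0 1]; ring
  · simp only [Fin.sum_univ_three, show (0 : Fin 3) + 1 = 1 from rfl, show (0 : Fin 3) + 2 = 2 from rfl,
      show (1 : Fin 3) + 1 = 2 from rfl, show (1 : Fin 3) + 2 = 0 from rfl, show (2 : Fin 3) + 1 = 0 from rfl,
      show (2 : Fin 3) + 2 = 1 from rfl, show (⟨2, by norm_num⟩ : Fin 3) = 2 from rfl]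
    rw [c 0 2, c 1 2]; ring

/-! ## 2. The potential `A = −curl(Δ⁻¹u)` -/

section Potential

variable {u : UnitAddTorus (Fin 3) → EuclideanSpace ℝ (Fin 3)} (hu : IsSmooth u) (hdiv : IsDivFree u)

include hu in
/-- Components of `Δ⁻¹u` are `Δ⁻¹` of the components. [folklore] -/
theorem invLaplacian_apply (x : UnitAddTorus (Fin 3)) (j : Fin 3) :
    Torus.invLaplacian u x j = Torus.invLaplacian (fun y => u y j) x := by
  have h := congrFun (invLaplacian_clm_comp hu (EuclideanSpace.proj j : EuclideanSpace ℝ (Fin 3) →L[ℝ] ℝ)) x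
  simp only [comp_apply] at h
  exact h.symm

include hu hdiv in
/-- **`div(Δ⁻¹u) = 0`** for divergence-free `u`. [folklore] -/
theorem divergence_invLaplacian (y : UnitAddTorus (Fin 3)) : Torus.divergence (Torus.invLaplacian u) y = 0 := by
  unfold Torus.divergence
  have h1 : ∀ j, (fun z => Torus.invLaplacian u z j) = Torus.invLaplacian (fun z => u z j) := fun j =>
    funext fun z => invLaplacian_apply hu z j
  have huj : ∀ j, IsSmooth (fun z => u z j) := fun j => hu.apply j
  simp_rw [h1]
  rw [show ∑ j, Torus.partialDeriv j (Torus.invLaplacian (fun z => u z j)) y =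
      ∑ j, Torus.invLaplacian (Torus.partialDeriv j (fun z => u z j)) y from
    Finset.sum_congr rfl fun j _ => partialDeriv_invLaplacian (huj j) j y]
  have h2 := congrFun (invLaplacian_finset_sum Finset.univ (A := fun j => Torus.partialDeriv j (fun z => u z j))
    fun j _ => (huj j).partialDeriv j) y
  rw [Finset.sum_apply] at h2
  rw [← h2]
  have h3 : (∑ j, Torus.partialDeriv j (fun z => u z j)) = 0 := by
    funext z; rw [Finset.sum_apply]; exact hdiv z
  rw [h3, invLaplacian_zero]; rfl

/-- **The potential** `A = −curl(Δ⁻¹u)`. [ours] -/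
def potential (u : UnitAddTorus (Fin 3) → EuclideanSpace ℝ (Fin 3)) : UnitAddTorus (Fin 3) → EuclideanSpace ℝ (Fin 3) :=
  -curlField (Torus.invLaplacian u)

include hu in
/-- The potential is smooth. [folklore] -/
theorem isSmooth_potential : IsSmooth (potential u) :=
  (isSmooth_curlField (isSmooth_invLaplacian hu)).neg

include hu hdiv in
/-- **`curl A = u − ∫u`** for `A = −curl(Δ⁻¹u)`, `u` smooth and divergence free. [folklore] -/
theorem curlField_potential (x : UnitAddTorus (Fin 3)) : curlField (potential u) x = u x - ∫ y, u y := by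
  have hB : IsSmooth (Torus.invLaplacian u) := isSmooth_invLaplacian hu
  have hcB : IsSmooth (curlField (Torus.invLaplacian u)) := isSmooth_curlField hB
  -- curl(−V) = −curl V
  have hneg : curlField (potential u) x = -curlField (curlField (Torus.invLaplacian u)) x := by
    ext i
    rw [PiLp.neg_apply, show potential u = fun y => -curlField (Torus.invLaplacian u) y from rfl, curlField_apply,
      curlField_apply, partialDeriv_neg, partialDeriv_neg]
    simp only [PiLp.neg_apply]; ring
  rw [hneg]
  ext i
  rw [PiLp.neg_apply, curl_curl hB, PiLp.sub_apply]
  -- first sum: ∂ᵢ(div Δ⁻¹u) = 0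
  have hfirst : ∑ j, Torus.partialDeriv i (Torus.partialDeriv j (Torus.invLaplacian u)) x j = 0 := by
    have e : ∀ j, Torus.partialDeriv i (Torus.partialDeriv j (Torus.invLaplacian u)) x j =
        Torus.partialDeriv i (fun y => Torus.partialDeriv j (Torus.invLaplacian u) y j) x := fun j =>
      (partialDeriv_apply_coord ((hB.partialDeriv j).isContDiff (by simp)) i x j).symm
    simp_rw [e]
    rw [← partialDeriv_finset_sum Finset.univ (fun j _ => ((hB.partialDeriv j).apply j).isContDiff (by simp))]
    have e2 : (fun y => ∑ j, Torus.partialDeriv j (Torus.invLaplacian u) y j) = fun y =>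
        Torus.divergence (Torus.invLaplacian u) y := by
      funext y
      unfold Torus.divergence
      exact Finset.sum_congr rfl fun j _ => (partialDeriv_apply_coord (hB.isContDiff (by simp)) j y j).symm
    rw [e2]
    have e3 : (fun y => Torus.divergence (Torus.invLaplacian u) y) = fun _ => (0 : ℝ) :=
      funext fun y => divergence_invLaplacian hu hdiv y
    rw [e3]
    simp [Torus.partialDeriv, Torus.lineDeriv]
  -- second sum: (ΔΔ⁻¹u)ᵢ = uᵢ − ∫uᵢ
  have hsecond : ∑ j, Torus.partialDeriv j (Torus.partialDeriv j (Torus.invLaplacian u)) x i = u x i - ∫ y, u y i := by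
    have e : ∀ j, Torus.partialDeriv j (Torus.partialDeriv j (Torus.invLaplacian u)) x i =
        Torus.partialDeriv j (Torus.partialDeriv j (Torus.invLaplacian (fun y => u y i))) x := by
      intro j
      rw [← partialDeriv_apply_coord ((hB.partialDeriv j).isContDiff (by simp)) j x i]
      have e1 : (fun y => Torus.partialDeriv j (Torus.invLaplacian u) y i) =
          Torus.partialDeriv j (Torus.invLaplacian (fun y => u y i)) := by
        funext y
        rw [← partialDeriv_apply_coord (hB.isContDiff (by simp)) j y i]
        congr 1
        funext z
        exact invLaplacian_apply hu z i
      rw [e1]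
    simp_rw [e]
    have hui : IsSmooth (fun y => u y i) := hu.apply i
    rw [← laplacian_eq_sum_partialDeriv_partialDeriv (isSmooth_invLaplacian hui), laplacian_invLaplacian hui]
  rw [hfirst, hsecond, zero_sub, neg_neg]
  -- `(∫u)_i = ∫u_i`
  congr 1
  have h := (EuclideanSpace.proj i : EuclideanSpace ℝ (Fin 3) →L[ℝ] ℝ).integral_comp_comm hu.integrable
  simpa using h

end Potential

/-! ## 3. Gradient statistics of `u − c` -/

section Stats

variable {u : UnitAddTorus (Fin 3) → EuclideanSpace ℝ (Fin 3)} (c : EuclideanSpace ℝ (Fin 3))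

/-- `∂ⱼ(u − c) = ∂ⱼu`. [folklore] -/
theorem partialDeriv_sub_const (hu : IsSmooth u) (j : Fin 3) (x : UnitAddTorus (Fin 3)) :
    Torus.partialDeriv j (fun y => u y - c) x = Torus.partialDeriv j u x := by
  rw [show (fun y => u y - c) = u - fun _ => c from rfl,
    partialDeriv_sub (hu.isContDiff (by simp)) ((isSmooth_const c).isContDiff (by simp))]
  simp [Torus.partialDeriv, Torus.lineDeriv]

/-- `ω(u − c) = ω(u)` componentwise. [folklore] -/
theorem vorticityComp_sub_const (hu : IsSmooth u) (x : UnitAddTorus (Fin 3)) (i : Fin 3) :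
    vorticityComp (fun y => u y - c) x i = vorticityComp u x i := by
  rw [vorticityComp_eq, vorticityComp_eq, partialDeriv_sub_const c hu, partialDeriv_sub_const c hu]

/-- `∇(u − c) = ∇u`. [folklore] -/
theorem gradAt_sub_const (hu : IsSmooth u) (x : UnitAddTorus (Fin 3)) :
    gradAt (fun y => u y - c) x = gradAt u x := by
  funext i j
  show Torus.partialDeriv j (fun y => u y - c) x i = Torus.partialDeriv j u x i
  rw [partialDeriv_sub_const c hu]

/-- `|ω(u − c)|² = |ω(u)|²`. [folklore] -/
theorem torusVorticitySqAt_sub_const (hu : IsSmooth u) (x : UnitAddTorus (Fin 3)) :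
    torusVorticitySqAt (fun y => u y - c) x = torusVorticitySqAt u x := by
  rw [torusVorticitySqAt_eq_sum_sq, torusVorticitySqAt_eq_sum_sq]
  simp only [vorticityComp_sub_const c hu]

/-- `T_ij(u − c) = T_ij(u)`. [folklore] -/
theorem vorticityMoment_sub_const (hu : IsSmooth u) (i j : Fin 3) :
    vorticityMoment (fun y => u y - c) i j = vorticityMoment u i j := by
  unfold vorticityMoment
  simp only [vorticityComp_sub_const c hu]

/-- `u − c` is smooth and divergence free with `u`. [folklore] -/
theorem isSmooth_sub_const (hu : IsSmooth u) : IsSmooth (fun y => u y - c) := hu.sub (isSmooth_const c)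

/-- `u − c` is divergence free with `u`. [folklore] -/
theorem isDivFree_sub_const (hu : IsSmooth u) (hdiv : IsDivFree u) : IsDivFree (fun y => u y - c) := by
  intro x
  have h := hdiv x
  unfold Torus.divergence at h ⊢
  rw [← h]
  refine Finset.sum_congr rfl fun i _ => ?_
  rw [partialDeriv_apply_coord ((isSmooth_sub_const c hu).isContDiff (by simp)),
    partialDeriv_apply_coord (hu.isContDiff (by simp)), partialDeriv_sub_const c hu]

/-- `ℰ(u − c) = ℰ(u)`. [folklore] -/
theorem torusEnstrophy_sub_const (hu : IsSmooth u) (hdiv : IsDivFree u) :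
    torusEnstrophy (fun y => u y - c) = torusEnstrophy u := by
  have h1 := two_mul_torusEnstrophy_eq_integral_vort (isSmooth_sub_const c hu) (isDivFree_sub_const c hu hdiv)
  have h2 := two_mul_torusEnstrophy_eq_integral_vort hu hdiv
  simp only [gradAt_sub_const c hu] at h1
  linarith

/-- `σ(u − c) = σ(u)`. [folklore] -/
theorem enstrophyProduction_sub_const (hu : IsSmooth u) (hdiv : IsDivFree u) :
    enstrophyProduction (fun y => u y - c) = enstrophyProduction u := by
  rw [enstrophyProduction_eq_integral_prodBC (isSmooth_sub_const c hu) (isDivFree_sub_const c hu hdiv),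
    enstrophyProduction_eq_integral_prodBC hu hdiv]
  simp only [gradAt_sub_const c hu]

end Stats

/-- **Potential form of a divergence-free field.** For smooth divergence-free `u` there is a smooth `A` whose
curl has the same pointwise `|ω|²`, enstrophy, production and second vorticity moments as `u`. [ours] -/
theorem exists_potential {u : UnitAddTorus (Fin 3) → EuclideanSpace ℝ (Fin 3)} (hu : IsSmooth u)
    (hdiv : IsDivFree u) :
    ∃ A : UnitAddTorus (Fin 3) → EuclideanSpace ℝ (Fin 3), IsSmooth A ∧
      (∀ x, torusVorticitySqAt (curlField A) x = torusVorticitySqAt u x) ∧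
      torusEnstrophy (curlField A) = torusEnstrophy u ∧
      enstrophyProduction (curlField A) = enstrophyProduction u ∧
      ∀ i j, vorticityMoment (curlField A) i j = vorticityMoment u i j := by
  have hc : curlField (potential u) = fun x => u x - ∫ y, u y := funext fun x => curlField_potential hu hdiv x
  refine ⟨potential u, isSmooth_potential hu, ?_, ?_, ?_, ?_⟩
  · intro x; rw [hc, torusVorticitySqAt_sub_const _ hu]
  · rw [hc, torusEnstrophy_sub_const _ hu hdiv]
  · rw [hc, enstrophyProduction_sub_const _ hu hdiv]
  · intro i j; rw [hc, vorticityMoment_sub_const _ hu]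

end Confinement

end Summit.NavierStokesRegularity.FunctionalMining

end
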